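import Summits.HodgeConjecture.CorCM.HypDel.MumfordModuliReceptacle
import Literature.AlgebraicGeometry.ModuliOfAbelianVarieties.SiegelAdelicMarkingHoms
import HarnessLib

/-!
# Mumford line under crux hDel (stmt-HodgeConjecture-24835): the receptacle's stub (U) `MarkingTransport` HOLDS

Cell hodgecm-mathlib (D-0151), #60 road / Mumford line (director g6 RULING s90; A-p05 (A3) step (B1⁗)/(B4)).
B-plan1's receptacle `Summits/HodgeConjecture/CorCM/HypDel/MumfordModuliReceptacle.lean` states the closed Prop
`MumfordModuli.MarkingTransport` («two adelic markings of ONE point `[J, a]` on `A`, `A₂` are intertwined by a homomorphism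
`e : A ⟶ A₂` with `e (u v) = u₂ v`»); this file WITNESSES it from the marking-level GAGA theorem
★ `SiegelAdelicMarking.exists_iso_forall_map_r_eq_self` (`Literature/…/SiegelAdelicMarkingHoms.lean` §5; the `e` is even an
isomorphism).  With B-p09's `Theorems/MumfordRouteXiAssembly.lean` (witnesses of (α), (α∀), (β), (C), (C∀)) every closed Prop of the
receptacle is then a theorem except the ONE booked named fact `deligne1971_siegelModuliOnPoints` (M1′, row #62).
THEOREMS ONLY (no definition, no named fact, no instance, no `sorry`).  HC_CM is proved only modulo the printed citations until rung 0 closes.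

References: [LangeBirkenhake1992] Ch. 1 Prop. 1.2.1, Ch. 2 Cor. 2.1.17 (homomorphisms of complex tori = lattice-compatible ℂ-linear maps);
[Milne2005ShimuraVarieties] §6 Thm. 6.11 p. 74 («an isomorphism `A → A′` … sending `ηK` to `η′K`»).
-/

set_option autoImplicit false

-- mandated namespace `Summit.HodgeConjecture.HodgeConjecture.Theorems` trips `linter.dupNamespace` (single-problem summit; the lakefile turns
-- the linter off tree-wide as a weak option), restated here so stand-alone elaboration is warning-free (as in ★ `HCCMUnconditionalHDelOfTwoFacts`).
set_option linter.dupNamespace false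

noncomputable section

namespace Summit.HodgeConjecture.HodgeConjecture.Theorems

namespace MumfordMarking

open CategoryTheory
open Literature.AlgebraicGeometry.ModuliOfAbelianVarieties
open Summit.HodgeConjecture.CorCM.HypDel

/-- **(U) HOLDS — marking transport**: for two markings `m`, `m₂` of the same point `[J, a]` on complex abelian varieties `A`, `A₂`
there is `e : A ⟶ A₂` with `e (m.r v) = m₂.r v` for every `v ∈ ℚ^{2g}` (★ `SiegelAdelicMarking.exists_iso_forall_map_r_eq_self`;
the `e` produced there is an isomorphism, of which only the forward homomorphism is recorded by the receptacle's text).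
[cite: LangeBirkenhake1992, Ch. 1 Prop. 1.2.1 and Ch. 2 Cor. 2.1.17] [cite: Milne2005ShimuraVarieties, §6 Thm. 6.11 p. 74] -/
theorem markingTransport_holds : MumfordModuli.MarkingTransport := by
  intro g δ J a A A₂ m m₂
  obtain ⟨e, he⟩ := m.exists_iso_forall_map_r_eq_self m₂
  exact ⟨e.hom, he⟩

/-- **The three-stub head of the receptacle with (U) discharged**: `SiegelS1` from the booked fact M1′ and the CM conjugation
isogeny (C) alone (`MumfordModuli.siegelS1_of_mumford` fed with `markingTransport_holds`).
[cite: Deligne1971TravauxShimura, Thm. 4.21 p. 152, 4.19–4.20 pp. 151–152] [cite: Milne2005ShimuraVarieties, §14 Prop. 14.12 p. 125] -/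
theorem siegelS1_of_mumford_of_cmConjugationIsogeny (hM : deligne1971_siegelModuliOnPoints)
    (hC : MumfordModuli.CMConjugationIsogeny) : SiegelS1 :=
  MumfordModuli.siegelS1_of_mumford hM markingTransport_holds hC

end MumfordMarking

end Summit.HodgeConjecture.HodgeConjecture.Theorems

end
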